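import Literature.Analysis.SpecialFunctions.LogTwoBounds
import HarnessLib

/-!
# Eleven-digit enclosures of `log p` for `p = 23, 37, 41, 43` (and twelve-digit `log 3`, `log 5`)

Transcendental input for the Schur cell certificates of the prime-deletion floors (`SemilocalDeletionSchurCells.lean`;
handoff-idea-1's CERT-SCHUR cells use the lags `log p`, `p ≤ 43`): the tree's `SemilocalLogAtoms*` files carry `log p` to
eleven digits for `p ≤ 19` and for `29, 31` (`SemilocalLogAtomsB/C`); here the remaining primes `≤ 43`, each from `log 2` to twenty digits
(`Literature.Analysis.SpecialFunctions.Real.log_two_gt_d20/lt_d20`) and a Taylor remainder of `log (1 − x)`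
(`Real.abs_log_sub_add_sum_range_le`) at a small rational `x`:
`log 3 = 2 log 2 + log(1 − 1/4)`, `log 5 = 2 log 2 + log(1 + 1/4)`, `2 log 23 = 9 log 2 + log(1 + 17/512)`,
`log 37 = 2 log 2 + 2 log 3 + log(1 + 1/36)`,
`log 41 = 10 log 2 − 2 log 5 + log(1 + 1/1024)`, `log 43 = 7 log 2 − log 3 + log(1 + 1/128)`.  Nothing here bears on RH.
-/

set_option linter.dupNamespace false

noncomputable section

open Real
open Literature.Analysis.SpecialFunctions.Real

namespace Summit.RiemannHypothesis.RiemannHypothesis.Theorems.SemilocalDeletionLogAtoms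

/-! ## `log 3` and `log 5` to twelve digits -/

/-- `log 3 > 1.098612288668`. -/
theorem log_three_gt_d12 : (1.098612288668 : ℝ) < Real.log 3 := by
  have t : |((1 : ℝ) / 4)| < 1 := by rw [abs_of_pos (by norm_num)]; norm_num
  have z := Real.abs_log_sub_add_sum_range_le t 24
  rw [abs_of_pos (by norm_num : (0 : ℝ) < 1 / 4)] at z
  norm_num [Finset.sum_range_succ] at z
  have e : Real.log (3 / 4) = Real.log 3 - 2 * Real.log 2 := by
    rw [Real.log_div (by norm_num) (by norm_num), show (4 : ℝ) = 2 ^ 2 by norm_num, Real.log_pow]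
    push_cast; ring
  rw [e] at z
  have h2 := log_two_gt_d20
  obtain ⟨z1, z2⟩ := abs_le.1 z
  linarith

/-- `log 3 < 1.098612288669`. -/
theorem log_three_lt_d12 : Real.log 3 < 1.098612288669 := by
  have t : |((1 : ℝ) / 4)| < 1 := by rw [abs_of_pos (by norm_num)]; norm_num
  have z := Real.abs_log_sub_add_sum_range_le t 24
  rw [abs_of_pos (by norm_num : (0 : ℝ) < 1 / 4)] at z
  norm_num [Finset.sum_range_succ] at z
  have e : Real.log (3 / 4) = Real.log 3 - 2 * Real.log 2 := by
    rw [Real.log_div (by norm_num) (by norm_num), show (4 : ℝ) = 2 ^ 2 by norm_num, Real.log_pow]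
    push_cast; ring
  rw [e] at z
  have h2 := log_two_lt_d20
  obtain ⟨z1, z2⟩ := abs_le.1 z
  linarith

/-- `log 5 > 1.609437912434`. -/
theorem log_five_gt_d12 : (1.609437912434 : ℝ) < Real.log 5 := by
  have t : |(-((1 : ℝ) / 4))| < 1 := by rw [abs_neg, abs_of_pos (by norm_num)]; norm_num
  have z := Real.abs_log_sub_add_sum_range_le t 24
  rw [abs_neg, abs_of_pos (by norm_num : (0 : ℝ) < 1 / 4)] at z
  norm_num [Finset.sum_range_succ] at z
  have e : Real.log (5 / 4) = Real.log 5 - 2 * Real.log 2 := by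
    rw [Real.log_div (by norm_num) (by norm_num), show (4 : ℝ) = 2 ^ 2 by norm_num, Real.log_pow]
    push_cast; ring
  rw [e] at z
  have h2 := log_two_gt_d20
  obtain ⟨z1, z2⟩ := abs_le.1 z
  linarith

/-- `log 5 < 1.609437912435`. -/
theorem log_five_lt_d12 : Real.log 5 < 1.609437912435 := by
  have t : |(-((1 : ℝ) / 4))| < 1 := by rw [abs_neg, abs_of_pos (by norm_num)]; norm_num
  have z := Real.abs_log_sub_add_sum_range_le t 24
  rw [abs_neg, abs_of_pos (by norm_num : (0 : ℝ) < 1 / 4)] at z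
  norm_num [Finset.sum_range_succ] at z
  have e : Real.log (5 / 4) = Real.log 5 - 2 * Real.log 2 := by
    rw [Real.log_div (by norm_num) (by norm_num), show (4 : ℝ) = 2 ^ 2 by norm_num, Real.log_pow]
    push_cast; ring
  rw [e] at z
  have h2 := log_two_lt_d20
  obtain ⟨z1, z2⟩ := abs_le.1 z
  linarith

/-! ## `log 23` (the tree already has `log 29`, `log 31`: `SemilocalLogAtomsB/C`, `log_twentynine_gt/lt`, `log_thirtyone_gt/lt`) -/

/-- `log 23 > 3.13549421592` (from `23² = 512·(1 + 17/512)`). -/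
theorem log_twentythree_gt_d11 : (3.13549421592 : ℝ) < Real.log 23 := by
  have t : |(-((17 : ℝ) / 512))| < 1 := by rw [abs_neg, abs_of_pos (by norm_num)]; norm_num
  have z := Real.abs_log_sub_add_sum_range_le t 10
  rw [abs_neg, abs_of_pos (by norm_num : (0 : ℝ) < 17 / 512)] at z
  norm_num [Finset.sum_range_succ] at z
  have e : Real.log (529 / 512) = 2 * Real.log 23 - 9 * Real.log 2 := by
    rw [Real.log_div (by norm_num) (by norm_num), show (529 : ℝ) = 23 ^ 2 by norm_num, show (512 : ℝ) = 2 ^ 9 by norm_num,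
      Real.log_pow, Real.log_pow]
    push_cast; ring
  rw [e] at z
  have h2 := log_two_gt_d20
  obtain ⟨z1, z2⟩ := abs_le.1 z
  linarith

/-- `log 23 < 3.13549421593`. -/
theorem log_twentythree_lt_d11 : Real.log 23 < 3.13549421593 := by
  have t : |(-((17 : ℝ) / 512))| < 1 := by rw [abs_neg, abs_of_pos (by norm_num)]; norm_num
  have z := Real.abs_log_sub_add_sum_range_le t 10
  rw [abs_neg, abs_of_pos (by norm_num : (0 : ℝ) < 17 / 512)] at z
  norm_num [Finset.sum_range_succ] at z
  have e : Real.log (529 / 512) = 2 * Real.log 23 - 9 * Real.log 2 := by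
    rw [Real.log_div (by norm_num) (by norm_num), show (529 : ℝ) = 23 ^ 2 by norm_num, show (512 : ℝ) = 2 ^ 9 by norm_num,
      Real.log_pow, Real.log_pow]
    push_cast; ring
  rw [e] at z
  have h2 := log_two_lt_d20
  obtain ⟨z1, z2⟩ := abs_le.1 z
  linarith

/-! ## `log 37`, `log 41`, `log 43` -/

/-- `log 37 > 3.61091791264` (from `37 = 36·(1 + 1/36)`). -/
theorem log_thirtyseven_gt_d11 : (3.61091791264 : ℝ) < Real.log 37 := by
  have t : |(-((1 : ℝ) / 36))| < 1 := by rw [abs_neg, abs_of_pos (by norm_num)]; norm_num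
  have z := Real.abs_log_sub_add_sum_range_le t 9
  rw [abs_neg, abs_of_pos (by norm_num : (0 : ℝ) < 1 / 36)] at z
  norm_num [Finset.sum_range_succ] at z
  have e : Real.log (37 / 36) = Real.log 37 - 2 * Real.log 2 - 2 * Real.log 3 := by
    rw [Real.log_div (by norm_num) (by norm_num), show (36 : ℝ) = 2 ^ 2 * 3 ^ 2 by norm_num,
      Real.log_mul (by norm_num) (by norm_num), Real.log_pow, Real.log_pow]
    push_cast; ring
  rw [e] at z
  have h2 := log_two_gt_d20
  have h3 := log_three_gt_d12
  obtain ⟨z1, z2⟩ := abs_le.1 z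
  linarith

/-- `log 37 < 3.61091791265`. -/
theorem log_thirtyseven_lt_d11 : Real.log 37 < 3.61091791265 := by
  have t : |(-((1 : ℝ) / 36))| < 1 := by rw [abs_neg, abs_of_pos (by norm_num)]; norm_num
  have z := Real.abs_log_sub_add_sum_range_le t 9
  rw [abs_neg, abs_of_pos (by norm_num : (0 : ℝ) < 1 / 36)] at z
  norm_num [Finset.sum_range_succ] at z
  have e : Real.log (37 / 36) = Real.log 37 - 2 * Real.log 2 - 2 * Real.log 3 := by
    rw [Real.log_div (by norm_num) (by norm_num), show (36 : ℝ) = 2 ^ 2 * 3 ^ 2 by norm_num,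
      Real.log_mul (by norm_num) (by norm_num), Real.log_pow, Real.log_pow]
    push_cast; ring
  rw [e] at z
  have h2 := log_two_lt_d20
  have h3 := log_three_lt_d12
  obtain ⟨z1, z2⟩ := abs_le.1 z
  linarith

/-- `log 41 > 3.71357206670` (from `41·25 = 1024·(1 + 1/1024)`). -/
theorem log_fortyone_gt_d11 : (3.71357206670 : ℝ) < Real.log 41 := by
  have t : |(-((1 : ℝ) / 1024))| < 1 := by rw [abs_neg, abs_of_pos (by norm_num)]; norm_num
  have z := Real.abs_log_sub_add_sum_range_le t 5
  rw [abs_neg, abs_of_pos (by norm_num : (0 : ℝ) < 1 / 1024)] at z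
  norm_num [Finset.sum_range_succ] at z
  have e : Real.log (1025 / 1024) = Real.log 41 + 2 * Real.log 5 - 10 * Real.log 2 := by
    rw [Real.log_div (by norm_num) (by norm_num), show (1025 : ℝ) = 41 * 5 ^ 2 by norm_num, show (1024 : ℝ) = 2 ^ 10 by norm_num,
      Real.log_mul (by norm_num) (by norm_num), Real.log_pow, Real.log_pow]
    push_cast; ring
  rw [e] at z
  have h2 := log_two_gt_d20
  have h5 := log_five_lt_d12
  obtain ⟨z1, z2⟩ := abs_le.1 z
  linarith

/-- `log 41 < 3.71357206671`. -/
theorem log_fortyone_lt_d11 : Real.log 41 < 3.71357206671 := by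
  have t : |(-((1 : ℝ) / 1024))| < 1 := by rw [abs_neg, abs_of_pos (by norm_num)]; norm_num
  have z := Real.abs_log_sub_add_sum_range_le t 5
  rw [abs_neg, abs_of_pos (by norm_num : (0 : ℝ) < 1 / 1024)] at z
  norm_num [Finset.sum_range_succ] at z
  have e : Real.log (1025 / 1024) = Real.log 41 + 2 * Real.log 5 - 10 * Real.log 2 := by
    rw [Real.log_div (by norm_num) (by norm_num), show (1025 : ℝ) = 41 * 5 ^ 2 by norm_num, show (1024 : ℝ) = 2 ^ 10 by norm_num,
      Real.log_mul (by norm_num) (by norm_num), Real.log_pow, Real.log_pow]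
    push_cast; ring
  rw [e] at z
  have h2 := log_two_lt_d20
  have h5 := log_five_gt_d12
  obtain ⟨z1, z2⟩ := abs_le.1 z
  linarith

/-- `log 43 > 3.76120011569` (from `43·3 = 128·(1 + 1/128)`). -/
theorem log_fortythree_gt_d11 : (3.76120011569 : ℝ) < Real.log 43 := by
  have t : |(-((1 : ℝ) / 128))| < 1 := by rw [abs_neg, abs_of_pos (by norm_num)]; norm_num
  have z := Real.abs_log_sub_add_sum_range_le t 7
  rw [abs_neg, abs_of_pos (by norm_num : (0 : ℝ) < 1 / 128)] at z
  norm_num [Finset.sum_range_succ] at z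
  have e : Real.log (129 / 128) = Real.log 43 + Real.log 3 - 7 * Real.log 2 := by
    rw [Real.log_div (by norm_num) (by norm_num), show (129 : ℝ) = 43 * 3 by norm_num, show (128 : ℝ) = 2 ^ 7 by norm_num,
      Real.log_mul (by norm_num) (by norm_num), Real.log_pow]
    push_cast; ring
  rw [e] at z
  have h2 := log_two_gt_d20
  have h3 := log_three_lt_d12
  obtain ⟨z1, z2⟩ := abs_le.1 z
  linarith

/-- `log 43 < 3.76120011570`. -/
theorem log_fortythree_lt_d11 : Real.log 43 < 3.76120011570 := by
  have t : |(-((1 : ℝ) / 128))| < 1 := by rw [abs_neg, abs_of_pos (by norm_num)]; norm_num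
  have z := Real.abs_log_sub_add_sum_range_le t 7
  rw [abs_neg, abs_of_pos (by norm_num : (0 : ℝ) < 1 / 128)] at z
  norm_num [Finset.sum_range_succ] at z
  have e : Real.log (129 / 128) = Real.log 43 + Real.log 3 - 7 * Real.log 2 := by
    rw [Real.log_div (by norm_num) (by norm_num), show (129 : ℝ) = 43 * 3 by norm_num, show (128 : ℝ) = 2 ^ 7 by norm_num,
      Real.log_mul (by norm_num) (by norm_num), Real.log_pow]
    push_cast; ring
  rw [e] at z
  have h2 := log_two_lt_d20
  have h3 := log_three_gt_d12
  obtain ⟨z1, z2⟩ := abs_le.1 z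
  linarith

end Summit.RiemannHypothesis.RiemannHypothesis.Theorems.SemilocalDeletionLogAtoms

end

-- Build note (cc-s2-1 gen13, 2026-08-24): comment-only re-land under lead ruling R14-3 (1) to trigger the missing hub
-- build of this module (p370662 accepted 2026-08-23T19:2xZ, no olean since); every declaration above is byte-identical.
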